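import Literature.AlgebraicGeometry.Motives.GrassmannianCharts
import HarnessLib

/-!
# The standard chart of the Grassmannian is an affine space: `chart x A ≃ {ψ : M →ₗ[R] Aᵏ // ψ ∘ x = e}`

Topic `Literature/AlgebraicGeometry/Motives`; namespace `Literature.AlgebraicGeometry.Motives`, prefix `Grassmannian.`.  Sequel to
`GrassmannianCharts` ((C1)+(C2)); cell hodgecm-mathlib key (h4) (author B-p21 (g15), partner B-p18 (g17)), deliverable (C4).
DEFINITIONS (the coordinate maps, non-Prop plumbing) + theorems; no instance, no notation, no `sorry`.

For a `k`-frame `x : Fin k → M` and an `R`-algebra `A`, a point `N ∈ chart x A` (the frame map `Aᵏ → (A ⊗ M)⧸N` is bijective)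
is the same as an `R`-linear COORDINATE MAP `ψ : M → Aᵏ` with `ψ(xᵢ) = eᵢ` ([Stacks 089T]; EGA I 9.7.4; Eisenbud–Harris §3.2.2:
«row-reduce so that the `I`-columns are the identity; the other `k(n−k)` entries are free coordinates»):

* `Grassmannian.coordMap x N hN : M →ₗ[R] (Fin k → A)` — `m ↦ (frame map)⁻¹ [1 ⊗ m]`; `coordMap_frame : coordMap (xᵢ) = eᵢ`;
* `Grassmannian.ofCoordMap x ψ hψ : G(k, A ⊗ M; A)` — the kernel of the `A`-linear extension `ψ̃ : A ⊗ M → Aᵏ` of `ψ` (surjective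
  since `ψ̃(1 ⊗ xᵢ) = eᵢ`; the quotient is `≅ Aᵏ`, free of rank `k`); `ofCoordMap_mem_chart`;
* **`Grassmannian.chartEquivCoordMaps x A : chart x A ≃ {ψ : M →ₗ[R] (Fin k → A) // ∀ i, ψ (x i) = Pi.single i 1}`** — the two
  constructions are inverse to each other.

For `M = Rⁿ` and `x = e ∘ I` (`I : Fin k ↪ Fin n`) the right-hand side is the set of `k × n` matrices over `A` with the `I`-columns
equal to the identity, i.e. `A^{k(n−k)}` — the functor of points of `𝔸^{k(n−k)}` (file `GrassmannianChartMatrix`, next).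
HC_CM is proved only modulo the 7 printed citations until rung 0 closes; nothing here is about HC.

## References
* [StacksProject, Tag 089T] (the standard open cover of the Grassmannian by affine spaces).
* [EisenbudHarris2016] D. Eisenbud, J. Harris, *3264 and All That* (2016), §3.2.2.
* A. Grothendieck, EGA I (Springer 1971), §9.7.4.
-/

set_option autoImplicit false

noncomputable section

universe u v w

open TensorProduct

namespace Literature.AlgebraicGeometry.Motives

namespace Grassmannian

variable {R : Type u} [CommRing R] {M : Type v} [AddCommGroup M] [Module R M] {k : ℕ}
variable {A : Type w} [CommRing A] [Algebra R A]

/-! ## §1 From a chart point to its coordinate map -/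

/-- **The coordinate map of `N ∈ chart x A`**: `M → Aᵏ`, `m ↦ (frameMap x N)⁻¹ [1 ⊗ m]` (`R`-linear; non-Prop plumbing).
[cite: StacksProject, Tag 089T] -/
def coordMap (x : Fin k → M) (N : Module.Grassmannian A (A ⊗[R] M) k) (hN : N ∈ chart R M k x A) : M →ₗ[R] (Fin k → A) :=
  (((frameEquiv x N hN).symm.toLinearMap ∘ₗ N.toSubmodule.mkQ).restrictScalars R) ∘ₗ TensorProduct.mk R A M 1

/-- The coordinate map, evaluated. [cite: StacksProject, Tag 089T] -/
theorem coordMap_apply (x : Fin k → M) (N : Module.Grassmannian A (A ⊗[R] M) k) (hN : N ∈ chart R M k x A) (m : M) :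
    coordMap x N hN m = (frameEquiv x N hN).symm (N.toSubmodule.mkQ ((1 : A) ⊗ₜ[R] m)) :=
  rfl

/-- **The coordinate map sends the frame to the standard basis**: `coordMap (xᵢ) = eᵢ`. [cite: StacksProject, Tag 089T] -/
theorem coordMap_frame (x : Fin k → M) (N : Module.Grassmannian A (A ⊗[R] M) k) (hN : N ∈ chart R M k x A) (i : Fin k) :
    coordMap x N hN (x i) = Pi.single i 1 := by
  rw [coordMap_apply, LinearEquiv.symm_apply_eq, frameEquiv_apply, frameMap_single]

/-- The `A`-linear extension of the coordinate map is `(frame map)⁻¹ ∘ (quotient map)`. [cite: StacksProject, Tag 089T] -/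
theorem liftBaseChange_coordMap (x : Fin k → M) (N : Module.Grassmannian A (A ⊗[R] M) k) (hN : N ∈ chart R M k x A) :
    (coordMap x N hN).liftBaseChange A = (frameEquiv x N hN).symm.toLinearMap ∘ₗ N.toSubmodule.mkQ := by
  refine TensorProduct.AlgebraTensorModule.ext fun a m => ?_
  rw [LinearMap.liftBaseChange_tmul, coordMap_apply, LinearMap.comp_apply, LinearEquiv.coe_toLinearMap, ← map_smul,
    ← map_smul, TensorProduct.smul_tmul', smul_eq_mul, mul_one]

/-- The coordinate map recovers `N`: `N = ker (coordMap x N)~`. [cite: StacksProject, Tag 089T] -/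
theorem ker_liftBaseChange_coordMap (x : Fin k → M) (N : Module.Grassmannian A (A ⊗[R] M) k) (hN : N ∈ chart R M k x A) :
    LinearMap.ker ((coordMap x N hN).liftBaseChange A) = N.toSubmodule := by
  rw [liftBaseChange_coordMap, LinearMap.ker_comp, LinearEquiv.ker, Submodule.comap_bot, Submodule.ker_mkQ]

/-! ## §2 From a coordinate map to a chart point -/

section OfCoordMap

variable (x : Fin k → M) (ψ : M →ₗ[R] (Fin k → A)) (hψ : ∀ i, ψ (x i) = Pi.single i 1)

include hψ in
/-- The `A`-linear extension `ψ̃ : A ⊗ M → Aᵏ` of a coordinate map hits `Σ vᵢ ⊗ xᵢ ↦ v`. [cite: StacksProject, Tag 089T] -/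
theorem liftBaseChange_sum_tmul_frame (v : Fin k → A) : ψ.liftBaseChange A (∑ i, v i ⊗ₜ[R] x i) = v := by
  rw [map_sum]
  conv_rhs => rw [← Finset.univ_sum_single v]
  refine Finset.sum_congr rfl fun i _ => ?_
  rw [LinearMap.liftBaseChange_tmul, hψ, ← Pi.single_smul, smul_eq_mul, mul_one]

include hψ in
/-- The `A`-linear extension of a coordinate map is SURJECTIVE (its image contains the standard basis).
[cite: StacksProject, Tag 089T] -/
theorem liftBaseChange_surjective : Function.Surjective (ψ.liftBaseChange A) :=
  fun v => ⟨∑ i, v i ⊗ₜ[R] x i, liftBaseChange_sum_tmul_frame x ψ hψ v⟩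

/-- **The chart point of a coordinate map**: `N_ψ := ker ψ̃ ∈ G(k, A ⊗ M; A)` — the quotient `(A ⊗ M)⧸ker ψ̃ ≅ Aᵏ` is free of
rank `k` (non-Prop plumbing). [cite: StacksProject, Tag 089T] -/
def ofCoordMap : Module.Grassmannian A (A ⊗[R] M) k :=
  haveI e := (ψ.liftBaseChange A).quotKerEquivOfSurjective (liftBaseChange_surjective x ψ hψ)
  { toSubmodule := LinearMap.ker (ψ.liftBaseChange A)
    finite_quotient := Module.Finite.equiv e.symm
    projective_quotient := Module.Projective.of_equiv e.symm
    rankAtStalk_eq := fun p => by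
      haveI : Nontrivial A :=
        nontrivial_of_ne 1 0 fun h => (Ideal.ne_top_iff_one _).1 p.2.ne_top (h ▸ p.asIdeal.zero_mem)
      rw [Module.rankAtStalk_eq_of_equiv e, Module.rankAtStalk_eq_finrank_of_free, Module.finrank_fin_fun]
      simp only [Pi.natCast_apply, Nat.cast_id] }

/-- The submodule of the chart point of `ψ` is `ker ψ̃`. [cite: StacksProject, Tag 089T] -/
@[simp]
theorem ofCoordMap_toSubmodule : (ofCoordMap x ψ hψ).toSubmodule = LinearMap.ker (ψ.liftBaseChange A) :=
  rfl

/-- The frame map of `N_ψ` followed by `(A ⊗ M)⧸ker ψ̃ ≅ Aᵏ` is the identity. [cite: StacksProject, Tag 089T] -/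
theorem quotKerEquivOfSurjective_frameMap (v : Fin k → A) :
    (ψ.liftBaseChange A).quotKerEquivOfSurjective (liftBaseChange_surjective x ψ hψ)
      (frameMap x (ofCoordMap x ψ hψ).toSubmodule v) = v := by
  change (ψ.liftBaseChange A).quotKerEquivOfSurjective (liftBaseChange_surjective x ψ hψ)
      (frameMap x (LinearMap.ker (ψ.liftBaseChange A)) v) = v
  rw [frameMap_apply, Submodule.mkQ_apply, LinearMap.quotKerEquivOfSurjective_apply_mk,
    liftBaseChange_sum_tmul_frame x ψ hψ v]

/-- **The chart point of a coordinate map lies in the chart.** [cite: StacksProject, Tag 089T] -/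
theorem ofCoordMap_mem_chart : ofCoordMap x ψ hψ ∈ chart R M k x A := by
  let e := (ψ.liftBaseChange A).quotKerEquivOfSurjective (liftBaseChange_surjective x ψ hψ)
  change Function.Bijective (frameMap x (LinearMap.ker (ψ.liftBaseChange A)))
  have h : (frameMap x (LinearMap.ker (ψ.liftBaseChange A)) : (Fin k → A) → _) = e.symm := by
    funext v
    exact (e.eq_symm_apply).2 (quotKerEquivOfSurjective_frameMap x ψ hψ v)
  rw [h]
  exact e.symm.bijective

/-- The frame equivalence of `N_ψ` is `((A ⊗ M)⧸ker ψ̃ ≅ Aᵏ)⁻¹`. [cite: StacksProject, Tag 089T] -/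
theorem frameEquiv_ofCoordMap_symm_apply (q : (A ⊗[R] M) ⧸ LinearMap.ker (ψ.liftBaseChange A)) :
    (frameEquiv x (ofCoordMap x ψ hψ) (ofCoordMap_mem_chart x ψ hψ)).symm q =
      (ψ.liftBaseChange A).quotKerEquivOfSurjective (liftBaseChange_surjective x ψ hψ) q := by
  rw [LinearEquiv.symm_apply_eq, frameEquiv_apply]
  obtain ⟨v, rfl⟩ := ((ψ.liftBaseChange A).quotKerEquivOfSurjective (liftBaseChange_surjective x ψ hψ)).symm.surjective q
  rw [LinearEquiv.apply_symm_apply]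
  exact ((LinearEquiv.eq_symm_apply _).2 (quotKerEquivOfSurjective_frameMap x ψ hψ v)).symm

/-- **Round trip 1**: the coordinate map of `N_ψ` is `ψ`. [cite: StacksProject, Tag 089T] -/
theorem coordMap_ofCoordMap : coordMap x (ofCoordMap x ψ hψ) (ofCoordMap_mem_chart x ψ hψ) = ψ := by
  refine LinearMap.ext fun m => ?_
  rw [coordMap_apply]
  change (frameEquiv x (ofCoordMap x ψ hψ) (ofCoordMap_mem_chart x ψ hψ)).symm
      ((LinearMap.ker (ψ.liftBaseChange A)).mkQ ((1 : A) ⊗ₜ[R] m)) = ψ m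
  rw [frameEquiv_ofCoordMap_symm_apply, Submodule.mkQ_apply, LinearMap.quotKerEquivOfSurjective_apply_mk,
    LinearMap.liftBaseChange_tmul, one_smul]

end OfCoordMap

/-- **Round trip 2**: the chart point of the coordinate map of `N` is `N`. [cite: StacksProject, Tag 089T] -/
theorem ofCoordMap_coordMap (x : Fin k → M) (N : Module.Grassmannian A (A ⊗[R] M) k) (hN : N ∈ chart R M k x A) :
    ofCoordMap x (coordMap x N hN) (coordMap_frame x N hN) = N :=
  Module.Grassmannian.ext (by rw [ofCoordMap_toSubmodule, ker_liftBaseChange_coordMap])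

/-! ## §3 The chart is the affine space of coordinate maps -/

variable (R M k) in
/-- **THE STANDARD CHART IS AN AFFINE SPACE**: `chart x A ≃ {ψ : M →ₗ[R] (Fin k → A) // ∀ i, ψ (x i) = Pi.single i 1}`, by
`N ↦ coordMap x N`, `ψ ↦ ker ψ̃` (non-Prop plumbing; natural in `A` — file `GrassmannianChartMatrix`).  For `M = Rⁿ`, `x = e ∘ I`,
the right-hand side is `A^{k(n−k)}`. [cite: StacksProject, Tag 089T] [cite: EisenbudHarris2016, §3.2.2] -/
def chartEquivCoordMaps (x : Fin k → M) (A : Type w) [CommRing A] [Algebra R A] :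
    chart R M k x A ≃ {ψ : M →ₗ[R] (Fin k → A) // ∀ i, ψ (x i) = Pi.single i 1} where
  toFun N := ⟨coordMap x N.1 N.2, coordMap_frame x N.1 N.2⟩
  invFun ψ := ⟨ofCoordMap x ψ.1 ψ.2, ofCoordMap_mem_chart x ψ.1 ψ.2⟩
  left_inv N := Subtype.ext (ofCoordMap_coordMap x N.1 N.2)
  right_inv ψ := Subtype.ext (coordMap_ofCoordMap x ψ.1 ψ.2)

/-- The equivalence, forwards. [cite: StacksProject, Tag 089T] -/
@[simp]
theorem chartEquivCoordMaps_apply (x : Fin k → M) (A : Type w) [CommRing A] [Algebra R A] (N : chart R M k x A) :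
    (chartEquivCoordMaps R M k x A N : M →ₗ[R] (Fin k → A)) = coordMap x N.1 N.2 :=
  rfl

/-- The equivalence, backwards. [cite: StacksProject, Tag 089T] -/
@[simp]
theorem chartEquivCoordMaps_symm_apply (x : Fin k → M) (A : Type w) [CommRing A] [Algebra R A]
    (ψ : {ψ : M →ₗ[R] (Fin k → A) // ∀ i, ψ (x i) = Pi.single i 1}) :
    ((chartEquivCoordMaps R M k x A).symm ψ : Module.Grassmannian A (A ⊗[R] M) k) = ofCoordMap x ψ.1 ψ.2 :=
  rfl

end Grassmannian

end Literature.AlgebraicGeometry.Motives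

end
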